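import Literature.MathematicalPhysics.QuantumFieldTheory.Balaban1983to89.B9Thm31GpAgmonL2LocalCoarseZd
import Literature.MathematicalPhysics.QuantumFieldTheory.Balaban1983to89.B9Thm31GpAgmonGradDivDecayClassZd

/-!
# `Balaban1983to89.B9Eq346AgmonL2CubeMemberZd` — [Balaban1985BackgroundPropagators] Thm 3.1 (3.46) p. 398, THE `L²`-LOCAL VALUE ENTRY AT EVERY CUBE MEMBER:
# ★★★ `‖𝟙_A G′(U₀)Ψ‖_τ ≤ B₀·(ηLᵐ)²·e^{−κL^{−m}D}·‖Ψ‖_τ` for `supp Ψ ⊂ B`, `dist_∞(A, B) ≥ D` — UNCONDITIONAL for the flat background (`B₀ = 2∕m₈`) and ON THE SMALL-PLAQUETTE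
# CLASS (`B₀ = 8∕m₈`), member-uniform explicit constants (FILE 6's coarse set-to-set reading on the level-data packages of FILES 13 ∕ 15)

statement-level skeleton of published theorems with citation tags; proofs where landed; nothing here is a claim about the
Yang–Mills mass gap

`[Balaban1985BackgroundPropagators]` ("B9", CMP **99** (1985) 389–434) Thm 3.1 p. 397, (3.46) p. 398 first entry: *«‖hG′(U)λ‖ ≤ B₀(Lʲη)(Lʲ′η)e^{−δ₀d(y,y′)}‖λ‖ for
h ∈ L²-functions with support in Δ(y), supp λ ⊂ Δ(y′)»* (`B9.pref6`, `B9.Ineq342_346_347` second block, n = 0).  `[Agmon1982]` Thm 1.5 p. 19.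
THIS FILE reads FILE 6's generic set-to-set bound `sq_sum_GpZd_le_exp_coarse` on the cube-member level data (`levelData_one_cubeMember`, `levelData_cubeMember_of_class`):
the two masses `M_A, M_B` are floored by `m₈(ηLᵐ)⁻²`, which produces print's `(Lʲη)(Lʲ′η)` at the coarsest scale `j = j′ = m`.

CITATION HEADER (lean-in-tree rule).  Cell `pub-ymgap` (YM Track A, HUMAN RULING D-0062 ∕ D-0149 width push), DAG node N06 = [B9], width seat
`pub-ymgap-dag-n06-w2` (g5), CLAIM-17.  Inputs BY NAME: FILE 6 `sq_sum_GpZd_le_exp_coarse`, FILE 13 `levelData_one_cubeMember`, FILE 15 `levelData_cubeMember_of_class`,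
dag-n06-w4 g5's `bgT_mem_unitaryUnits_of_pdev`.  Nothing restated.

WHAT IS PROVED (kernel, 0 sorry, 0 def; no `instance`, no `notation`).
* ★★★ `sq_sum_GpZd_one_le_exp_cubeMember` — flat: `Σ_{z∈□₀∩A}|(G′(1)Ψ)(z)|²_τ ≤ (2∕m₈)²(ηLᵐ)⁴e^{−2κL^{−m}D}‖Ψ‖²_τ` (`0 ≤ κ ≤ 1`, `κ(12d+30a_hi) ≤ m₈`).
* ★★★ `sq_sum_GpZd_le_exp_cubeMember_of_class` — class: the same with `(8∕m₈)²` (`κ(48d+120a_hi) ≤ m₈`, class letters of FILE 12).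

HONEST SCOPE.  (i) Coarsest-scale amplitude `(ηLᵐ)²` and rate `κL^{−m}` in `|·|_∞` set distance; NOT print's `(Lʲη)(Lʲ′η)` on inner shells nor `d(y,y′)`; (ii) the other
five entries of (3.46) (gradient ∕ divergence ∕ Laplacian `L²` entries) are NOT here (FILE 9 holds the generic gradient `L²` bound); (iii) squared form (no square roots).
Count-neutral; N05 ∕ N06 NOT discharged; K1⁹ `stmt-QuantumFields-27364` NOT closed; one finite `𝕋⁴` programme at fixed `ε`, Bałaban as printed; R4 closes only the
conditional finite-`𝕋⁴` rung `BalabanLadder.UV` — nothing continuum ∕ ℝ⁴ ∕ OS ∕ mass gap ∕ Clay.  Unit `pub-ymgap-dag-n06-w2` (g5), 2026-08-28.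
-/

noncomputable section

open scoped BigOperators

namespace Literature.MathematicalPhysics.QuantumFieldTheory.Balaban1983to89.B9Eq346AgmonL2CubeMemberZd

open B7Prop1Explicit (e)
open B7Prop2Explicit (unitaryUnits pdev C0 c2')
open B8Eq119TwistedAxial (bgT bgT_one)
open B8Eq131CubesAdmissible (cubeFam)
open B8LeafModelZd (ZdIdx)
open B8Eq191FlatLettersCubeMember (cubeLamS_finite)
open B9Thm311PosDefOpenZd (cubeMember_Ω0_finite)
open B9Eq321LandauProjectionZd (suppSub formE formE_apply)
open B9Eq324DeltaPrimeAZd (single restrictSite deltaPrimeADom GpZd)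
open B9Eq325QprimeSingleSiteZd (blockMapIter)
open B9Eq342CombesThomasFormZd
open B9Thm31GpAgmonL2LocalCoarseZd (sq_sum_GpZd_le_exp_coarse)
open B9Thm31GpAgmonGradDecayZd (levelData_one_cubeMember)
open B9Thm31GpAgmonGradDivDecayClassZd (levelData_cubeMember_of_class)
open B9Thm31NearFlatTransportersZd (bgT_mem_unitaryUnits_of_pdev)
open LatticeNorms (linfDist)

export B7Prop1Explicit (Site)

variable {d : ℕ} {𝔸 : Type*} [CStarAlgebra 𝔸]

variable (L : ℕ) (τ : 𝔸 →ₗ[ℂ] ℂ) [FiniteDimensional ℝ 𝔸] (hτp : ∀ a : 𝔸, a ≠ 0 → 0 < (τ (star a * a)).re)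

omit [CStarAlgebra 𝔸] in
/-- the amplitude algebra: with `m_A = m_B = μ₀ = m₈(ηLᵐ)⁻²`, `1∕(((1−θ)c₀)²μ₀²E²) = ((ηLᵐ)²∕((1−θ)c₀m₈))²∕E²`. [cite: Balaban1985BackgroundPropagators, (3.46) p.398 (bookkeeping)] -/
theorem inv_mass_sq_eq {c m₈ t E : ℝ} (hc : c ≠ 0) (hm : m₈ ≠ 0) (ht : t ≠ 0) (hE : E ≠ 0) :
    1 / (c ^ 2 * (m₈ * (t ^ 2)⁻¹) * (m₈ * (t ^ 2)⁻¹) * E ^ 2) = (t ^ 2 / (c * m₈)) ^ 2 / E ^ 2 := by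
  field_simp

/-- ★★★ **[B9] THM 3.1's (3.46), n = 0 SHAPE, FOR `G′(1)` AT EVERY CUBE MEMBER — UNCONDITIONAL, MEMBER-UNIFORM EXPLICIT CONSTANTS.**  `2 ≤ L ≤ ρc`, `m ≤ i.k`, `τ` tracial
Hermitian faithful on a finite-dimensional nontrivial fibre, print-scaled weights `a_lo(Lᵈ)ʲ(ηLʲ)⁻² ≤ a_j ≤ a_hi(Lᵈ)ʲ(ηLʲ)⁻²` (`j ≤ m`), `m₈ = min{8, a_lo}`, `0 ≤ κ ≤ 1` with
`κ(12d + 30a_hi) ≤ m₈`; finite site sets `A`, `B` (`B` nonempty) with `D ≤ |z − y|_∞` for `z ∈ A`, `y ∈ B`, `A, B ⊆ □₀`; `Ψ ∈ L²(□₀, ·)` vanishing off `B`.  THEN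
`Σ_{z∈□₀∩A}|(G′(1)Ψ)(z)|²_τ ≤ ((2∕m₈)(ηLᵐ)²)²·e^{−2κL^{−m}D}·‖Ψ‖²_τ`.
[cite: Balaban1985BackgroundPropagators, Thm 3.1 p.397, (3.46) p.398, (3.24) p.394; Balaban1985RegularSpaces, (1.131) p.99; Agmon1982, Thm 1.5 p.19] -/
theorem sq_sum_GpZd_one_le_exp_cubeMember [Nontrivial 𝔸] (hd : 0 < d) (hL : 2 ≤ L) (hτt : ∀ a b : 𝔸, τ (a * b) = τ (b * a))
    (hτs : ∀ a : 𝔸, τ (star a) = starRingEnd ℂ (τ a)) (i : ZdIdx d L) {ac : Site d} {Mc ρc : ℕ} (hΩ : i.Ω = cubeFam false L ac Mc ρc i.k)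
    (hρc : L ≤ ρc) {m : ℕ} (hm : m ≤ i.k) {a : ℕ → ℝ} (ha : ∀ j, 0 ≤ a j) {a_lo a_hi : ℝ} (halo : 0 < a_lo)
    (hlo : ∀ j ∈ Finset.range (m + 1), a_lo * ((L : ℝ) ^ d) ^ j * ((i.η * (L : ℝ) ^ j) ^ 2)⁻¹ ≤ a j)
    (hhi : ∀ j ∈ Finset.range (m + 1), a j ≤ a_hi * ((L : ℝ) ^ d) ^ j * ((i.η * (L : ℝ) ^ j) ^ 2)⁻¹)
    {κ : ℝ} (hκ0 : 0 ≤ κ) (hκ1 : κ ≤ 1) (hκ : κ * (12 * d + 30 * a_hi) ≤ min 8 a_lo)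
    {A B : Finset (Site d)} (hAS : A ⊆ (cubeMember_Ω0_finite i hΩ).toFinset) (hBS : B ⊆ (cubeMember_Ω0_finite i hΩ).toFinset) (hBne : B.Nonempty)
    {D : ℕ} (hsep : ∀ z ∈ A, ∀ y ∈ B, D ≤ linfDist z y)
    {Ψ : suppSub (𝔸 := 𝔸) (cubeMember_Ω0_finite i hΩ).toFinset} (hΨB : ∀ z, z ∉ B → (Ψ : Site d → 𝔸) z = 0) :
    ∑ z ∈ (cubeMember_Ω0_finite i hΩ).toFinset ∩ A,
        fnorm τ ((GpZd L (1 : Site d → Fin d → 𝔸ˣ) i.η τ hτp m a (fun j => (cubeLamS_finite L ac Mc ρc i.k m j).toFinset)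
          (cubeMember_Ω0_finite i hΩ).toFinset hd i.hη.ne' hτt hτs (fun _ _ => (unitaryUnits 𝔸).one_mem) ha Ψ : Site d → 𝔸) z) ^ 2 ≤
      (2 / min 8 a_lo * (i.η * (L : ℝ) ^ m) ^ 2) ^ 2 / Real.exp (κ * (((L : ℝ) ^ m)⁻¹ * (D : ℝ))) ^ 2 *
        formE τ (cubeMember_Ω0_finite i hΩ).toFinset Ψ Ψ := by
  haveI : NeZero L := ⟨by omega⟩
  have hL1 : 1 ≤ L := le_trans one_le_two hL
  have hL0 : (0 : ℝ) < L := by exact_mod_cast (lt_of_lt_of_le zero_lt_two hL)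
  have hη0 : 0 < i.η := i.hη
  set m₈ : ℝ := min 8 a_lo with hm₈
  have hm₈0 : 0 < m₈ := lt_min (by norm_num) halo
  obtain ⟨M, hM0, hco, hB, hA, hfloor⟩ := levelData_one_cubeMember L τ hτp hL hτt hτs i hΩ hρc hm ha halo hlo hhi
  have hT : ∀ j', j' < m → ∀ z y' : Site d, bgT L (1 : Site d → Fin d → 𝔸ˣ) j' z y' ∈ unitaryUnits 𝔸 := fun j' _ z y' => by
    rw [bgT_one]; exact (unitaryUnits 𝔸).one_mem
  have hκ' : κ * (6 * d * m₈⁻¹ + 15 * (a_hi * m₈⁻¹)) ≤ 1 / 2 * 1 := by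
    have h1 : κ * (6 * d * m₈⁻¹ + 15 * (a_hi * m₈⁻¹)) = (κ * (12 * d + 30 * a_hi)) / (2 * m₈) := by
      field_simp
      ring
    rw [h1, mul_one, div_le_iff₀ (by positivity), show (1 : ℝ) / 2 * (2 * m₈) = m₈ by ring]
    exact hκ
  set μ₀ : ℝ := m₈ * ((i.η * (L : ℝ) ^ m) ^ 2)⁻¹ with hμ₀
  have hμ₀pos : 0 < μ₀ := by positivity
  have hmain := sq_sum_GpZd_le_exp_coarse L (1 : Site d → Fin d → 𝔸ˣ) i.η τ hτp m a
    (fun j => (cubeLamS_finite L ac Mc ρc i.k m j).toFinset) (cubeMember_Ω0_finite i hΩ).toFinset hd i.hη.ne' hL1 hτt hτs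
    (fun _ _ => (unitaryUnits 𝔸).one_mem) hT ha one_pos (by norm_num : (0 : ℝ) ≤ 1 / 2) (by norm_num : (1 : ℝ) / 2 < 1) hM0 hco hκ0 hκ1 hκ' hB hA
    hμ₀pos hμ₀pos hBne hsep (fun z hz => hfloor z (hAS hz)) (fun z hz => hfloor z (hBS hz)) hΨB
  refine hmain.trans (le_of_eq ?_)
  have hE : Real.exp (κ * (((L : ℝ) ^ m)⁻¹ * (D : ℝ))) ≠ 0 := (Real.exp_pos _).ne'
  have ht : i.η * (L : ℝ) ^ m ≠ 0 := by positivity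
  rw [div_eq_mul_one_div (formE τ _ Ψ Ψ), mul_comm (formE τ _ Ψ Ψ), show ((1 : ℝ) - 1 / 2) * 1 = 1 / 2 by norm_num,
    inv_mass_sq_eq (by norm_num : (1 : ℝ) / 2 ≠ 0) hm₈0.ne' ht hE]
  congr 1
  rw [show (1 : ℝ) / 2 * m₈ = m₈ / 2 by ring, div_div_eq_mul_div]
  ring

/-- ★★★ **[B9] THM 3.1's (3.46), n = 0 SHAPE, FOR `G′(U₀)` AT EVERY CUBE MEMBER AND EVERY BACKGROUND OF THE SMALL-PLAQUETTE CLASS.**  Class letters of FILE 12 ∕ 15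
(`ηLᵐ ≤ 1`, `L^{−k} ≤ η`, fibre comparison `C_u, C_l`, `pdev U₀ < α₀(L^{−k})²`, `C0 d α₀ ≤ 1∕3`, `2α₀ ≤ c2′ d L`, `‖U₀(x,μ) − 1‖ ≤ θ′η`, CLASS smallness), print-scaled weights,
`0 ≤ κ ≤ 1`, `κ(48d + 120a_hi) ≤ m₈`; sets `A, B ⊆ □₀` at `ℓ∞`-distance `≥ D`, `Ψ` vanishing off `B`.  THEN
`Σ_{z∈□₀∩A}|(G′(U₀)Ψ)(z)|²_τ ≤ ((8∕m₈)(ηLᵐ)²)²·e^{−2κL^{−m}D}·‖Ψ‖²_τ`.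
[cite: Balaban1985BackgroundPropagators, Thm 3.1 p.397, (3.46) p.398, Thm 3.11 p.416, (3.24) p.394; Balaban1985Averaging, Prop. 2 p.26, (122)–(126) p.36; Balaban1985RegularSpaces, (1.131) p.99; Agmon1982, Thm 1.5 p.19] -/
theorem sq_sum_GpZd_le_exp_cubeMember_of_class [Nontrivial 𝔸] (hd : 0 < d) (hL : 2 ≤ L) (hτt : ∀ a b : 𝔸, τ (a * b) = τ (b * a))
    (hτs : ∀ a : 𝔸, τ (star a) = starRingEnd ℂ (τ a)) {Cu Cl : ℝ} (hCu : ∀ a : 𝔸, fnorm τ a ≤ Cu * ‖a‖) (hCl : ∀ a : 𝔸, ‖a‖ ≤ Cl * fnorm τ a)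
    (hCu0 : 0 ≤ Cu) (hCl0 : 0 ≤ Cl) (i : ZdIdx d L) {ac : Site d} {Mc ρc : ℕ} (hΩ : i.Ω = cubeFam false L ac Mc ρc i.k)
    (hρc : L ≤ ρc) {m : ℕ} (hm : m ≤ i.k) (hηm : i.η * (L : ℝ) ^ m ≤ 1) (hkη : ((L : ℝ) ^ i.k)⁻¹ ≤ i.η)
    {a : ℕ → ℝ} (ha : ∀ j, 0 ≤ a j) {a_lo a_hi : ℝ} (halo : 0 < a_lo)
    (hlo : ∀ j ∈ Finset.range (m + 1), a_lo * ((L : ℝ) ^ d) ^ j * ((i.η * (L : ℝ) ^ j) ^ 2)⁻¹ ≤ a j)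
    (hhi : ∀ j ∈ Finset.range (m + 1), a j ≤ a_hi * ((L : ℝ) ^ d) ^ j * ((i.η * (L : ℝ) ^ j) ^ 2)⁻¹)
    {U₀ : Site d → Fin d → 𝔸ˣ} (hU : ∀ (x : Site d) (κ' : Fin d), U₀ x κ' ∈ unitaryUnits 𝔸)
    {α₀ : ℝ} (hα : 0 < α₀) (hα3 : C0 d * α₀ ≤ 1 / 3) (hα2 : 2 * α₀ ≤ c2' d L) (h52 : pdev U₀ < α₀ * (((L : ℝ) ^ i.k)⁻¹) ^ 2)
    {θ' : ℝ} (hθ' : 0 ≤ θ') (hR : ∀ (x : Site d) (μ : Fin d), ‖((U₀ x μ : 𝔸ˣ) : 𝔸) - 1‖ ≤ θ' * i.η)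
    (hsmall : 4 * ((2 * Cu * Cl) ^ 2 * (d * θ' ^ 2 + a_hi * d ^ 2 * (L : ℝ) ^ 2 * (256 * (d + 1) * (d + 4) * α₀ + θ') ^ 2)) ≤ min 8 a_lo)
    {κ : ℝ} (hκ0 : 0 ≤ κ) (hκ1 : κ ≤ 1) (hκ : κ * (48 * d + 120 * a_hi) ≤ min 8 a_lo)
    {A B : Finset (Site d)} (hAS : A ⊆ (cubeMember_Ω0_finite i hΩ).toFinset) (hBS : B ⊆ (cubeMember_Ω0_finite i hΩ).toFinset) (hBne : B.Nonempty)
    {D : ℕ} (hsep : ∀ z ∈ A, ∀ y ∈ B, D ≤ linfDist z y)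
    {Ψ : suppSub (𝔸 := 𝔸) (cubeMember_Ω0_finite i hΩ).toFinset} (hΨB : ∀ z, z ∉ B → (Ψ : Site d → 𝔸) z = 0) :
    ∑ z ∈ (cubeMember_Ω0_finite i hΩ).toFinset ∩ A,
        fnorm τ ((GpZd L U₀ i.η τ hτp m a (fun j => (cubeLamS_finite L ac Mc ρc i.k m j).toFinset)
          (cubeMember_Ω0_finite i hΩ).toFinset hd i.hη.ne' hτt hτs hU ha Ψ : Site d → 𝔸) z) ^ 2 ≤
      (8 / min 8 a_lo * (i.η * (L : ℝ) ^ m) ^ 2) ^ 2 / Real.exp (κ * (((L : ℝ) ^ m)⁻¹ * (D : ℝ))) ^ 2 *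
        formE τ (cubeMember_Ω0_finite i hΩ).toFinset Ψ Ψ := by
  haveI : NeZero L := ⟨by omega⟩
  have hL1 : 1 ≤ L := le_trans one_le_two hL
  have hL0 : (0 : ℝ) < L := by exact_mod_cast (lt_of_lt_of_le zero_lt_two hL)
  have hη0 : 0 < i.η := i.hη
  set m₈ : ℝ := min 8 a_lo with hm₈
  have hm₈0 : 0 < m₈ := lt_min (by norm_num) halo
  obtain ⟨M, hM0, hco, hB, hA, hfloor⟩ := levelData_cubeMember_of_class L τ hτp hL hτt hτs hCu hCl hCu0 hCl0 i hΩ hρc hm hηm hkη ha halo hlo hhi hU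
    hα hα3 hα2 h52 hθ' hR hsmall
  have hT : ∀ i', i' < m → ∀ z y' : Site d, bgT L U₀ i' z y' ∈ unitaryUnits 𝔸 := fun i' hi' z y' =>
    bgT_mem_unitaryUnits_of_pdev hL i.k hU hα hα3 hα2 h52 (by omega) z y'
  have hκ' : κ * (6 * d * m₈⁻¹ + 15 * (a_hi * m₈⁻¹)) ≤ 1 / 2 * (1 / 4) := by
    have h1 : κ * (6 * d * m₈⁻¹ + 15 * (a_hi * m₈⁻¹)) = (κ * (48 * d + 120 * a_hi)) / (8 * m₈) := by
      field_simp
      ring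
    rw [h1, div_le_iff₀ (by positivity), show (1 : ℝ) / 2 * (1 / 4) * (8 * m₈) = m₈ by ring]
    exact hκ
  set μ₀ : ℝ := m₈ * ((i.η * (L : ℝ) ^ m) ^ 2)⁻¹ with hμ₀
  have hμ₀pos : 0 < μ₀ := by positivity
  have hmain := sq_sum_GpZd_le_exp_coarse L U₀ i.η τ hτp m a
    (fun j => (cubeLamS_finite L ac Mc ρc i.k m j).toFinset) (cubeMember_Ω0_finite i hΩ).toFinset hd i.hη.ne' hL1 hτt hτs hU hT ha
    (by norm_num : (0 : ℝ) < 1 / 4) (by norm_num : (0 : ℝ) ≤ 1 / 2) (by norm_num : (1 : ℝ) / 2 < 1) hM0 hco hκ0 hκ1 hκ' hB hA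
    hμ₀pos hμ₀pos hBne hsep (fun z hz => hfloor z (hAS hz)) (fun z hz => hfloor z (hBS hz)) hΨB
  refine hmain.trans (le_of_eq ?_)
  have hE : Real.exp (κ * (((L : ℝ) ^ m)⁻¹ * (D : ℝ))) ≠ 0 := (Real.exp_pos _).ne'
  have ht : i.η * (L : ℝ) ^ m ≠ 0 := by positivity
  rw [div_eq_mul_one_div (formE τ _ Ψ Ψ), mul_comm (formE τ _ Ψ Ψ), show ((1 : ℝ) - 1 / 2) * (1 / 4) = 1 / 8 by norm_num,
    inv_mass_sq_eq (by norm_num : (1 : ℝ) / 8 ≠ 0) hm₈0.ne' ht hE]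
  congr 1
  rw [show (1 : ℝ) / 8 * m₈ = m₈ / 8 by ring, div_div_eq_mul_div]
  ring

end Literature.MathematicalPhysics.QuantumFieldTheory.Balaban1983to89.B9Eq346AgmonL2CubeMemberZd

end
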